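import Mathlib
import Summits.Ventures.PercRepro2.TwoHullMasterKeyed
import Summits.Ventures.PercRepro2.TwoHullMasterBlocksGlue

/-!
# A pendant graph keeps a keyed cover keyed (blind cell PercRepro2, night-4 g40, 2026-08-29;
proofs/NIGHT4-G40.md §15)

Glue an arbitrary graph at a vertex `c` of the side (`Glue.IsGluing`) that every keyed block
classifies (`c ∈ Before ∪ At ∪ After`).  On the blocks with `c ∉ At` the pendant's edges become
FREE coordinates (red «up» when `c` is before the key, blue «up» when after); on the blocks with
`c ∈ At` the pendant's colouring is a block parameter, complemented with the interface bit.  The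
pendant's vertices inherit the class of `c`.  The hull pairs of the glued graph are the side pairs
with the pendant's pair attached (`hullPair_glue_pend`), and the membership of a side vertex or a
pendant vertex in them is read off the side (`mem_pendPair_fst_side`, `mem_pendPair_fst_pend`, …).
the free blocks are keyed (**`keyedBlock_pend_free`**); the merged blocks and the cover theorem
**`keyedCover_pend`** are in TwoHullMasterKeyedPendCover.lean.
-/

namespace Summit.Ventures.PercRepro2

namespace Blocks

open Hull LocRows Path2 Glue Glue2

open scoped Classical

universe u

variable {V : Type*} {E₁ : Type*} {E₂ : Type u} {ends₁ : E₁ → Sym2 V} {ends₂ : E₂ → Sym2 V}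
  {c l h : V} {V₁ V₂ : Set V}

/-! ## §1 Membership in an attached pair -/

/-- `pendPair` is monotone in both pairs. -/
lemma pendPair_mono {q₁ q₁' q₂ q₂' : Set V × Set V} (h₁ : PairLE q₁ q₁') (h₂ : PairLE q₂ q₂') :
    PairLE (pendPair q₁ c q₂) (pendPair q₁' c q₂') := by
  refine ⟨?_, ?_⟩
  · rintro x (hx | ⟨hc, hx⟩)
    · exact Or.inl (h₁.1 hx)
    · exact Or.inr ⟨h₁.1 hc, h₂.1 hx⟩
  · rintro x (hx | ⟨hc, hx⟩)
    · exact Or.inl (h₁.2 hx)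
    · exact Or.inr ⟨h₁.2 hc, h₂.2 hx⟩

/-- A side vertex lies in the first component of an attached pair iff in the side's. -/
lemma mem_pendPair_fst_side (hg : IsGluing ends₁ ends₂ c V₁ V₂) {q₁ q₂ : Set V × Set V}
    (hq₂ : q₂.1 ⊆ V₂) {x : V} (hx : x ∈ V₁) : x ∈ (pendPair q₁ c q₂).1 ↔ x ∈ q₁.1 := by
  constructor
  · rintro (h | ⟨hc, h⟩)
    · exact h
    · have := hg.inter x hx (hq₂ h)
      rw [this]; exact hc
  · exact Or.inl

/-- A side vertex lies in the second component of an attached pair iff in the side's. -/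
lemma mem_pendPair_snd_side (hg : IsGluing ends₁ ends₂ c V₁ V₂) {q₁ q₂ : Set V × Set V}
    (hq₂ : q₂.2 ⊆ V₂) {x : V} (hx : x ∈ V₁) : x ∈ (pendPair q₁ c q₂).2 ↔ x ∈ q₁.2 := by
  constructor
  · rintro (h | ⟨hc, h⟩)
    · exact h
    · have := hg.inter x hx (hq₂ h)
      rw [this]; exact hc
  · exact Or.inl

/-- A pendant vertex other than `c` lies in the first component iff `c` does on the side and the
vertex in the pendant. -/
lemma mem_pendPair_fst_pend (hg : IsGluing ends₁ ends₂ c V₁ V₂) {q₁ q₂ : Set V × Set V}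
    (hq₁ : q₁.1 ⊆ V₁) {x : V} (hx : x ∈ V₂) (hxc : x ≠ c) :
    x ∈ (pendPair q₁ c q₂).1 ↔ c ∈ q₁.1 ∧ x ∈ q₂.1 := by
  constructor
  · rintro (h | h)
    · exact absurd (hg.inter x (hq₁ h) hx) hxc
    · exact h
  · exact Or.inr

/-- The second-component version. -/
lemma mem_pendPair_snd_pend (hg : IsGluing ends₁ ends₂ c V₁ V₂) {q₁ q₂ : Set V × Set V}
    (hq₁ : q₁.2 ⊆ V₁) {x : V} (hx : x ∈ V₂) (hxc : x ≠ c) :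
    x ∈ (pendPair q₁ c q₂).2 ↔ c ∈ q₁.2 ∧ x ∈ q₂.2 := by
  constructor
  · rintro (h | h)
    · exact absurd (hg.inter x (hq₁ h) hx) hxc
    · exact h
  · exact Or.inr

/-- The hull pair of a side vertex lies in the side. -/
lemma hullPair_subset_side (hg : IsGluing ends₁ ends₂ c V₁ V₂) (ζ₁ : Config E₁) {v : V}
    (hv : v ∈ V₁) : (hullPair ends₁ ζ₁ v).1 ⊆ V₁ ∧ (hullPair ends₁ ζ₁ v).2 ⊆ V₁ :=
  ⟨cluster_subset_of_mem hg hv, cluster_subset_of_mem hg hv⟩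

/-- The hull pair of `c` in the pendant lies in the pendant. -/
lemma hullPair_subset_pend (hg : IsGluing ends₁ ends₂ c V₁ V₂) (ζ₂ : Config E₂) :
    (hullPair ends₂ ζ₂ c).1 ⊆ V₂ ∧ (hullPair ends₂ ζ₂ c).2 ⊆ V₂ :=
  ⟨cluster_subset_of_mem₂ hg hg.c_mem₂, cluster_subset_of_mem₂ hg hg.c_mem₂⟩

/-! ## §2 The blocks of the glued graph -/

variable {β : Type*} {ι : β → Type u}

/-- The block indices of the glued graph: the blocks where `c` is not at the key, with the pendant
free, and the blocks where it is, with the pendant's colouring as a parameter. -/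
def pendβ (E₂ : Type u) (At : β → Set V) (c : V) : Type _ :=
  {b : β // c ∉ At b} ⊕ ({b : β // c ∈ At b} × Config E₂)

/-- The coordinates of the glued blocks. -/
def pendι (ι : β → Type u) (At : β → Set V) (c : V) : pendβ (β := β) E₂ At c → Type u
  | Sum.inl b => ι b.1 ⊕ E₂
  | Sum.inr bc => ι bc.1.1

/-- The pendant's colouring at a point of a free block: red is «up» before the key, blue after. -/
noncomputable def freePend (Before : β → Set V) (c : V) (b : β) (ζ₂ : Config E₂) : Config E₂ :=
  if c ∈ Before b then ζ₂ else blue ζ₂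

/-- The points of the glued blocks. -/
noncomputable def pendPt' (pt : ∀ b, (ι b → Bool) → Config E₁) (sbit : ∀ b, (ι b → Bool) → Bool)
    (Before At : β → Set V) (c : V) :
    (b' : pendβ (β := β) E₂ At c) → (pendι ι At c b' → Bool) → Config (E₁ ⊕ E₂)
  | Sum.inl b, ε => pair (pt b.1 (ε ∘ Sum.inl)) (freePend Before c b.1 (ε ∘ Sum.inr))
  | Sum.inr bc, ε => pair (pt bc.1.1 ε) (if sbit bc.1.1 ε = true then blue bc.2 else bc.2)

/-- The interface bit of the glued blocks. -/
def pendSbit (sbit : ∀ b, (ι b → Bool) → Bool) (At : β → Set V) (c : V) :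
    (b' : pendβ (β := β) E₂ At c) → (pendι ι At c b' → Bool) → Bool
  | Sum.inl b, ε => sbit b.1 (ε ∘ Sum.inl)
  | Sum.inr bc, ε => sbit bc.1.1 ε

/-- The vertices before the key of a glued block. -/
def pendBefore (Before At : β → Set V) (c : V) (V₂ : Set V) : pendβ (β := β) E₂ At c → Set V
  | Sum.inl b => Before b.1 ∪ (if c ∈ Before b.1 then V₂ else ∅)
  | Sum.inr bc => Before bc.1.1

/-- The key vertices of a glued block. -/
def pendAt (At : β → Set V) (c : V) (V₂ : Set V) : pendβ (β := β) E₂ At c → Set V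
  | Sum.inl b => At b.1
  | Sum.inr bc => At bc.1.1 ∪ V₂

/-- The vertices after the key of a glued block. -/
def pendAfter (Before At After : β → Set V) (c : V) (V₂ : Set V) :
    pendβ (β := β) E₂ At c → Set V
  | Sum.inl b => After b.1 ∪ (if c ∈ Before b.1 then ∅ else V₂)
  | Sum.inr bc => After bc.1.1

/-! ## §3 The glued blocks are keyed -/

variable {pt : ∀ b, (ι b → Bool) → Config E₁} {sbit : ∀ b, (ι b → Bool) → Bool}
  {Before At After : β → Set V}

/-- `freePend` commutes with the colour swap. -/
lemma freePend_blue (Before : β → Set V) (c : V) (b : β) (ζ₂ : Config E₂) :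
    freePend Before c b (blue ζ₂) = blue (freePend Before c b ζ₂) := by
  simp only [freePend]
  split_ifs <;> rfl

/-- `freePend` is injective. -/
lemma freePend_injective (Before : β → Set V) (c : V) (b : β) :
    Function.Injective (freePend (E₂ := E₂) Before c b) := by
  intro ζ ζ' hζ
  by_cases hc : c ∈ Before b
  · simpa [freePend, hc] using hζ
  · have : blue ζ = blue ζ' := by simpa [freePend, hc] using hζ
    exact blue_injective this

/-- The colour swap is antitone. -/
lemma blue_anti {E : Type*} {ζ ζ' : Config E} (h : ζ ≤ ζ') : blue ζ' ≤ blue ζ := by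
  intro e
  have := h e
  simp only [blue]
  revert this
  cases ζ e <;> cases ζ' e <;> simp

/-- The colour swap of a sum configuration, second summand. -/
lemma cubeNot_sum_inr {ι₁ : Type*} (ε : ι₁ ⊕ E₂ → Bool) :
    (cubeNot ε ∘ Sum.inr : Config E₂) = blue (ε ∘ Sum.inr) := rfl

/-- Membership of a side vertex in the glued hull pair of a side vertex `v`. -/
lemma mem_glue_pair_side (hg : IsGluing ends₁ ends₂ c V₁ V₂) {v : V} (hv : v ∈ V₁)
    (ζ₁ : Config E₁) (ζ₂ : Config E₂) {x : V} (hx : x ∈ V₁) :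
    (x ∈ (hullPair (Glue.glue ends₁ ends₂) (pair ζ₁ ζ₂) v).1 ↔ x ∈ (hullPair ends₁ ζ₁ v).1) ∧
    (x ∈ (hullPair (Glue.glue ends₁ ends₂) (pair ζ₁ ζ₂) v).2 ↔ x ∈ (hullPair ends₁ ζ₁ v).2) := by
  rw [hullPair_glue_pend hg hv, pair_inl, pair_inr]
  exact ⟨mem_pendPair_fst_side hg (hullPair_subset_pend hg ζ₂).1 hx,
    mem_pendPair_snd_side hg (hullPair_subset_pend hg ζ₂).2 hx⟩

/-- Membership of a pendant vertex other than `c` in the glued hull pair of a side vertex `v`. -/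
lemma mem_glue_pair_pend (hg : IsGluing ends₁ ends₂ c V₁ V₂) {v : V} (hv : v ∈ V₁)
    (ζ₁ : Config E₁) (ζ₂ : Config E₂) {x : V} (hx : x ∈ V₂) (hxc : x ≠ c) :
    (x ∈ (hullPair (Glue.glue ends₁ ends₂) (pair ζ₁ ζ₂) v).1 ↔
        c ∈ (hullPair ends₁ ζ₁ v).1 ∧ x ∈ (hullPair ends₂ ζ₂ c).1) ∧
    (x ∈ (hullPair (Glue.glue ends₁ ends₂) (pair ζ₁ ζ₂) v).2 ↔
        c ∈ (hullPair ends₁ ζ₁ v).2 ∧ x ∈ (hullPair ends₂ ζ₂ c).2) := by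
  rw [hullPair_glue_pend hg hv, pair_inl, pair_inr]
  exact ⟨mem_pendPair_fst_pend hg (hullPair_subset_side hg ζ₁ hv).1 hx hxc,
    mem_pendPair_snd_pend hg (hullPair_subset_side hg ζ₁ hv).2 hx hxc⟩

/-- A vertex of the pendant inherits the side's exclusion of `c` from a hull pair. -/
lemma notMem_glue_pair_of_c (hg : IsGluing ends₁ ends₂ c V₁ V₂) {v : V} (hv : v ∈ V₁)
    (ζ₁ : Config E₁) (ζ₂ : Config E₂) {x : V} (hx : x ∈ V₂) :
    (c ∉ (hullPair ends₁ ζ₁ v).1 → x ∉ (hullPair (Glue.glue ends₁ ends₂) (pair ζ₁ ζ₂) v).1) ∧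
    (c ∉ (hullPair ends₁ ζ₁ v).2 → x ∉ (hullPair (Glue.glue ends₁ ends₂) (pair ζ₁ ζ₂) v).2) := by
  by_cases hxc : x = c
  · subst hxc
    exact ⟨fun hc => (mem_glue_pair_side hg hv ζ₁ ζ₂ hg.c_mem₁).1.not.2 hc,
      fun hc => (mem_glue_pair_side hg hv ζ₁ ζ₂ hg.c_mem₁).2.not.2 hc⟩
  · exact ⟨fun hc h => hc ((mem_glue_pair_pend hg hv ζ₁ ζ₂ hx hxc).1.1 h).1,
      fun hc h => hc ((mem_glue_pair_pend hg hv ζ₁ ζ₂ hx hxc).2.1 h).1⟩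

/-- **A free block of the glued graph is keyed.** -/
theorem keyedBlock_pend_free (hg : IsGluing ends₁ ends₂ c V₁ V₂) (hl : l ∈ V₁) (hh : h ∈ V₁)
    (hhc : h ≠ c) (b : {b : β // c ∉ At b})
    (hk : KeyedBlock ends₁ l h (pt b.1) (sbit b.1) (Before b.1) (At b.1) (After b.1))
    (hclass : c ∈ Before b.1 ∨ c ∈ After b.1)
    (hsub : Before b.1 ⊆ V₁ ∧ At b.1 ⊆ V₁ ∧ After b.1 ⊆ V₁) :
    KeyedBlock (Glue.glue ends₁ ends₂) l h (pendPt' (E₂ := E₂) pt sbit Before At c (Sum.inl b))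
      (pendSbit (E₂ := E₂) sbit At c (Sum.inl b)) (pendBefore (E₂ := E₂) Before At c V₂ (Sum.inl b))
      (pendAt (E₂ := E₂) At c V₂ (Sum.inl b))
      (pendAfter (E₂ := E₂) Before At After c V₂ (Sum.inl b)) := by
  have hζ : ∀ ε : pendι (E₂ := E₂) ι At c (Sum.inl b) → Bool, pendPt' (E₂ := E₂) pt sbit Before At c (Sum.inl b) ε =
      pair (pt b.1 (ε ∘ Sum.inl)) (freePend Before c b.1 (ε ∘ Sum.inr)) := fun ε => rfl
  have hPl : ∀ ε : pendι (E₂ := E₂) ι At c (Sum.inl b) → Bool, hullPair (Glue.glue ends₁ ends₂) (pendPt' pt sbit Before At c (Sum.inl b) ε) l =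
      pendPair (hullPair ends₁ (pt b.1 (ε ∘ Sum.inl)) l) c
        (hullPair ends₂ (freePend Before c b.1 (ε ∘ Sum.inr)) c) := fun ε => by
    rw [hζ, hullPair_glue_pend hg hl, pair_inl, pair_inr]
  have hPh : ∀ ε : pendι (E₂ := E₂) ι At c (Sum.inl b) → Bool, hullPair (Glue.glue ends₁ ends₂) (pendPt' pt sbit Before At c (Sum.inl b) ε) h =
      pendPair (hullPair ends₁ (pt b.1 (ε ∘ Sum.inl)) h) c
        (hullPair ends₂ (freePend Before c b.1 (ε ∘ Sum.inr)) c) := fun ε => by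
    rw [hζ, hullPair_glue_pend hg hh, pair_inl, pair_inr]
  have hmem : ∀ ε : pendι (E₂ := E₂) ι At c (Sum.inl b) → Bool, h ∉ hull (Glue.glue ends₁ ends₂) (pendPt' pt sbit Before At c (Sum.inl b) ε) l :=
    fun ε => by rw [hζ, notMem_hull_glue_iff hg hl hh hhc, pair_inl]; exact hk.block.mem _
  have hcB : c ∈ Before b.1 → ∀ ε : pendι (E₂ := E₂) ι At c (Sum.inl b) → Bool,
      hullPair (Glue.glue ends₁ ends₂) (pendPt' pt sbit Before At c (Sum.inl b) ε) h =
        hullPair ends₁ (pt b.1 (ε ∘ Sum.inl)) h := fun hc ε => by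
    rw [hPh]; exact pendPair_eq_of_notMem (hk.before c hc _).1 (hk.before c hc _).2
  have hcA : c ∈ After b.1 → ∀ ε : pendι (E₂ := E₂) ι At c (Sum.inl b) → Bool,
      hullPair (Glue.glue ends₁ ends₂) (pendPt' pt sbit Before At c (Sum.inl b) ε) l =
        hullPair ends₁ (pt b.1 (ε ∘ Sum.inl)) l := fun hc ε => by
    rw [hPl]; exact pendPair_eq_of_notMem (hk.after c hc _).1 (hk.after c hc _).2
  have hpendNot : ∀ ε : pendι (E₂ := E₂) ι At c (Sum.inl b) → Bool,
      freePend Before c b.1 (cubeNot ε ∘ Sum.inr) = blue (freePend Before c b.1 (ε ∘ Sum.inr)) :=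
    fun ε => by
      show freePend Before c b.1 (blue (ε ∘ Sum.inr)) = _
      rw [freePend_blue]
  have hsbit : ∀ ε : pendι (E₂ := E₂) ι At c (Sum.inl b) → Bool, pendSbit (E₂ := E₂) sbit At c (Sum.inl b) ε = sbit b.1 (ε ∘ Sum.inl) :=
    fun ε => rfl
  refine ⟨⟨?_, hmem, ?_, ?_, ?_⟩, ?_, ?_, ?_, ?_, ?_, ?_, ?_, ?_⟩
  · -- injective
    intro ε ε' heq
    rw [hζ, hζ] at heq
    have h1 := congrArg (fun ξ => ξ ∘ Sum.inl) heq
    have h2 := congrArg (fun ξ => ξ ∘ Sum.inr) heq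
    simp only [pair_inl, pair_inr] at h1 h2
    have f1 := hk.block.inj h1
    have f2 := freePend_injective Before c b.1 h2
    funext x
    cases x with
    | inl x => exact congrFun f1 x
    | inr x => exact congrFun f2 x
  · -- P_l monotone
    intro ε ε' hle
    by_cases hc : c ∈ Before b.1
    · rw [hPl, hPl]
      refine pendPair_mono (hk.block.l_mono fun x => hle (Sum.inl x)) ?_
      simp only [freePend, hc, if_true]
      exact hullPair_mono (fun e => hle (Sum.inr e)) c
    · have hA : c ∈ After b.1 := hclass.resolve_left hc
      rw [hcA hA, hcA hA]
      exact hk.block.l_mono fun x => hle (Sum.inl x)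
  · -- P_h antitone
    intro ε ε' hle
    by_cases hc : c ∈ Before b.1
    · rw [hcB hc, hcB hc]
      exact hk.block.h_anti fun x => hle (Sum.inl x)
    · rw [hPh, hPh]
      refine pendPair_mono (hk.block.h_anti fun x => hle (Sum.inl x)) ?_
      simp only [freePend, hc, if_false]
      exact hullPair_mono (blue_anti fun e => hle (Sum.inr e)) c
  · -- mirror
    rcases hk.block.mirror with hm | hm
    · left
      intro ε
      rw [hPl, hPl, hpendNot, hullPair_blue, pendPair_swap]
      congr 1
      exact hm (ε ∘ Sum.inl)
    · right
      intro ε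
      rw [hPh, hPh, hpendNot, hullPair_blue, pendPair_swap]
      congr 1
      exact hm (ε ∘ Sum.inl)
  · intro ε ε' hle
    rw [hsbit, hsbit]
    exact hk.sbit_mono fun x => hle (Sum.inl x)
  · intro ε
    rw [hsbit, hsbit]
    exact hk.sbit_not _
  · -- before
    intro x hx ε
    rw [hζ]
    simp only [pendBefore] at hx
    rcases hx with hx | hx
    · rw [(mem_glue_pair_side hg hh _ _ (hsub.1 hx)).1, (mem_glue_pair_side hg hh _ _ (hsub.1 hx)).2]
      exact hk.before x hx _
    · split_ifs at hx with hc
      · exact ⟨(notMem_glue_pair_of_c hg hh _ _ hx).1 (hk.before c hc _).1,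
          (notMem_glue_pair_of_c hg hh _ _ hx).2 (hk.before c hc _).2⟩
      · exact absurd hx (Set.notMem_empty x)
  · -- after
    intro x hx ε
    rw [hζ]
    simp only [pendAfter] at hx
    rcases hx with hx | hx
    · rw [(mem_glue_pair_side hg hl _ _ (hsub.2.2 hx)).1,
        (mem_glue_pair_side hg hl _ _ (hsub.2.2 hx)).2]
      exact hk.after x hx _
    · split_ifs at hx with hc
      · exact absurd hx (Set.notMem_empty x)
      · have hA : c ∈ After b.1 := hclass.resolve_left hc
        exact ⟨(notMem_glue_pair_of_c hg hl _ _ hx).1 (hk.after c hA _).1,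
          (notMem_glue_pair_of_c hg hl _ _ hx).2 (hk.after c hA _).2⟩
  · intro x hx ε hs
    rw [hζ, (mem_glue_pair_side hg hl _ _ (hsub.2.1 hx)).1]
    exact hk.at_l_red x hx _ hs
  · intro x hx ε hs
    rw [hζ, (mem_glue_pair_side hg hl _ _ (hsub.2.1 hx)).2]
    exact hk.at_l_blue x hx _ hs
  · intro x hx ε hs
    rw [hζ, (mem_glue_pair_side hg hh _ _ (hsub.2.1 hx)).1]
    exact hk.at_h_red x hx _ hs
  · intro x hx ε hs
    rw [hζ, (mem_glue_pair_side hg hh _ _ (hsub.2.1 hx)).2]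
    exact hk.at_h_blue x hx _ hs

end Blocks

end Summit.Ventures.PercRepro2
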